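import Summits.Ventures.PercRepro.Night2LocalRuleGoodTwo
import Summits.Ventures.PercRepro.Night2ShapeOneMainC

/-!
# night-2: the distance-2 rule `dshGT2` at targets that receive no distance-2 share

`dshGT2` agrees with `dshGT` on every pair `(B, z)` whose lossy set `insert z B` has a good point, and on every
pair without good points and without distance-2 targets; on a pair with distance-2 targets it replaces the
missed-point fallback by the distance-2 shares.  Hence, termwise, `dshGT2 B z S ≤ dshGT B z S` as soon as `S`
is not a distance-2 target of a covered pair, and the column bound of `dshGT` at targets with at most one
coloop off `K` (`dload_gt_le_cap2_of_card_coloops_le_one'''`) transfers to `dshGT2` at every such target that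
no covered pair loads at distance 2.  The complementary case (a covered pair loads `S` at distance 2) is the
distance-2 analysis proper.
-/

namespace PercRepro.Shadow

open PercRepro.ThmH PercRepro.PerFlat

variable {α : Type*} [DecidableEq α] {M : Matroid α} [M.Finite] {G : Finset α} {q : ℕ}

/-- A nonzero `dshGT2` share lands on a good target, a distance-2 target or a missed target of the pair. -/
theorem mem_targets_of_dshGT2_ne_zero {B : Finset α} {z : α} {S : Finset α}
    (h : dshGT2 M q G B z S ≠ 0) :
    S ∈ gtTargets M q G B z ∨ S ∈ d2Targets M q G (insert z B) ∨ S ∈ missedTargets M G B z := by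
  unfold dshGT2 dshMissed at h
  split_ifs at h with h1 h2 h3 h4 h5
  · exact Or.inl h2
  · exact absurd rfl h
  · exact Or.inr (Or.inl h4)
  · exact absurd rfl h
  · exact Or.inr (Or.inr h5)
  · exact absurd rfl h

/-- Termwise: `dshGT2 ≤ dshGT` on a pair that does not load `S` at distance 2. -/
theorem dshGT2_le_dshGT_of_not_d2 (hG : G ∈ flatsQ M (q + 1)) (hd : (gr M \ G).card ≤ q)
    {B : Finset α} {z : α} {S : Finset α}
    (h : (gtPts M q G (insert z B)).Nonempty ∨ S ∉ d2Targets M q G (insert z B)) :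
    dshGT2 M q G B z S ≤ dshGT M q G B z S := by
  unfold dshGT2 dshGT
  by_cases hg : (gtPts M q G (insert z B)).Nonempty
  · simp only [hg, if_true]
    exact le_rfl
  · simp only [hg, if_false]
    rcases h with h | h
    · exact absurd h hg
    · by_cases hn : (d2Targets M q G (insert z B)).Nonempty
      · simp only [hn, if_true, h, if_false]
        exact dshMissed_nonneg hG hd B z S
      · simp only [hn, if_false]
        exact le_rfl

/-- The `dshGT2` load is at most the `dshGT` load at a target that no pair loads at distance 2. -/
theorem dload_gt2_le_dload_gt_of_not_d2 (hG : G ∈ flatsQ M (q + 1)) (hd : (gr M \ G).card ≤ q)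
    {P : Finset α → Prop} [DecidablePred P] {S : Finset α}
    (h : ∀ B ∈ thinMembers M q G, P B → ∀ z ∈ G \ clF M B,
      (gtPts M q G (insert z B)).Nonempty ∨ S ∉ d2Targets M q G (insert z B)) :
    dload M q G P (dshGT2 M q G) S ≤ dload M q G P (dshGT M q G) S := by
  unfold dload
  refine Finset.sum_le_sum fun B hB => Finset.sum_le_sum fun z hz => ?_
  rw [Finset.mem_filter] at hB
  exact dshGT2_le_dshGT_of_not_d2 hG hd (h B hB.1 hB.2 z hz)

/-- The column bound of `dshGT2` at a target with at most one coloop off `K` that no covered pair loads at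
distance 2: it is the `dshGT` bound `dload_gt_le_cap2_of_card_coloops_le_one'''`. -/
theorem dload_gt2_le_cap2_of_card_coloops_le_one_of_not_d2 (hG : G ∈ flatsQ M (5 + 1))
    (hd : (gr M \ G).card = 2) (hk : kColoops M G = 1)
    (hs : ∀ e ∈ gr M, ∀ f ∈ gr M, e ≠ f → rkN M {e, f} = 2) (hl : ∀ e ∈ gr M, M.Indep {e})
    (hfat : (fatClosures M 5 G 2).card ≤ 1) {S : Finset α} (hSG : S ⊆ G) (hKS : coloops M G ⊆ S)
    (hc1 : (coloops M (S \ coloops M G)).card ≤ 1)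
    (h : ∀ B ∈ thinMembers M 5 G, bigP M G B → ∀ z ∈ G \ clF M B,
      (gtPts M 5 G (insert z B)).Nonempty ∨ S ∉ d2Targets M 5 G (insert z B)) :
    dload M 5 G (bigP M G) (dshGT2 M 5 G) S ≤ cap2 M 5 G S :=
  (dload_gt2_le_dload_gt_of_not_d2 hG (by omega) h).trans
    (dload_gt_le_cap2_of_card_coloops_le_one''' hG hd hk hs hl hfat hSG hKS hc1)

end PercRepro.Shadow
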